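import Summits.RiemannHypothesis.RiemannHypothesis.Theorems.Splittings.JensenDegenerateCriticalCore

/-!
# Splittings / Jensen — the DEGENERATE-CRITICAL-POINT witness `G_{c,K}` — FILE 3/4: TAYLOR POSITIVITY, CERTIFIED SIGNS, CRITICAL POINTS (§6–§8) and the polynomial toy (§14)

Carve of `HOME/rh-split-jen-neg/g8/stage/JensenDegenerateCritical.lean` (6de8f964827225eb); definitions and the full
mathematical header live in `JensenDegenerateCriticalDefs.lean`; declaration blocks byte-identical to the stage file.

Contents: §6 Taylor coefficients at `0` positive (`c > 0`, `K > 2(c² + 12c + 120)`); §7 certified signs for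
`c₀ = 1/1000`, `K₀ = 1203/5` (origin, `-c₀`, sea points, Laguerre at sea points); §8 the real critical points of `G`;
§14 the quartic toy `Ptoy` (same mechanism for polynomials: `P′` hyperbolic ∧ NON-STRICT Laguerre at critical points
⇏ `P` hyperbolic).
-/

set_option linter.dupNamespace false

namespace Summit.RiemannHypothesis.RiemannHypothesis.Theorems.Splittings.JensenDegenerateCritical

open Complex
open scoped Real ComplexConjugate Nat
open Literature.Barriers.RiemannHypothesis
open Literature.NumberTheory.LFunctions (jensenPoly exists_sq_eq iteratedDeriv_conj_of_conj)
open Literature.Analysis.TotalPositivity (IsEntireOfOrderLtOne)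
open Literature.Analysis.Complex (IsEntireOfOrderLt HasNoFourierCriticalPoint)
open Summit.RiemannHypothesis.RiemannHypothesis.Theorems.Splittings.JensenMixedSplit

/-! ## §6 Taylor coefficients at `0` are positive (`c > 0`, `K > 2(c²+12c+120)`) -/

/-- `((· + c)²)^{(i)}(0) = (2)_i · c^{2-i}`. -/
theorem iteratedDeriv_add_const_sq_zero (c : ℂ) (i : ℕ) :
    iteratedDeriv i (fun w : ℂ ↦ (w + c) ^ 2) 0 = (Nat.descFactorial 2 i : ℂ) * c ^ (2 - i) := by
  have h := iteratedDeriv_comp_add_const i (fun x : ℂ ↦ x ^ 2) c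
  rw [h]
  simp only [zero_add, iteratedDeriv_pow]

/-- Leibniz: `((w+c)² · C)^{(m)}(0) = Σ_i (m choose i) · (2)_i c^{2-i} · (m-i)!/(2(m-i))!`. -/
theorem iteratedDeriv_sq_mul_coshSqrt_zero (c : ℝ) (m : ℕ) :
    iteratedDeriv m (fun w : ℂ ↦ (w + c) ^ 2 * coshSqrt w) 0 =
      ((∑ i ∈ Finset.range (m + 1), (m.choose i : ℝ) * ((Nat.descFactorial 2 i : ℝ) * c ^ (2 - i))
        * (((m - i)! : ℝ) / ((2 * (m - i))! : ℝ)) : ℝ) : ℂ) := by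
  have hf : ContDiffAt ℂ m (fun w : ℂ ↦ (w + c) ^ 2) 0 := by fun_prop
  have hg : ContDiffAt ℂ m coshSqrt 0 := (differentiable_coshSqrt.contDiff).contDiffAt
  have e : (fun w : ℂ ↦ (w + c) ^ 2 * coshSqrt w) = (fun w : ℂ ↦ (w + c) ^ 2) * coshSqrt := rfl
  rw [e, iteratedDeriv_mul hf hg, Complex.ofReal_sum]
  refine Finset.sum_congr rfl fun i _ ↦ ?_
  rw [iteratedDeriv_coshSqrt_zero, iteratedDeriv_add_const_sq_zero]
  push_cast
  ring

/-- Hence `G^{(m+1)}(0)` is real and, for `c > 0`, positive. -/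
theorem iteratedDeriv_succ_G_zero (c K : ℝ) (m : ℕ) :
    iteratedDeriv (m + 1) (G c K) 0 =
      ((∑ i ∈ Finset.range (m + 1), (m.choose i : ℝ) * ((Nat.descFactorial 2 i : ℝ) * c ^ (2 - i))
        * (((m - i)! : ℝ) / ((2 * (m - i))! : ℝ)) : ℝ) : ℂ) := by
  rw [iteratedDeriv_succ', show deriv (G c K) = fun w : ℂ ↦ (w + c) ^ 2 * coshSqrt w from
    funext (deriv_G c K), iteratedDeriv_sq_mul_coshSqrt_zero]

/-- For `c > 0` every Taylor coefficient `Re G^{(m+1)}(0)` (`m ≥ 0`) is positive. -/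
theorem re_iteratedDeriv_succ_G_zero_pos {c : ℝ} (hc : 0 < c) (K : ℝ) (m : ℕ) :
    0 < (iteratedDeriv (m + 1) (G c K) 0).re := by
  rw [iteratedDeriv_succ_G_zero, Complex.ofReal_re]
  have h0 : 0 < (m.choose 0 : ℝ) * ((Nat.descFactorial 2 0 : ℝ) * c ^ (2 - 0))
      * (((m - 0)! : ℝ) / ((2 * (m - 0))! : ℝ)) := by
    simp only [Nat.choose_zero_right, Nat.cast_one, Nat.descFactorial_zero, one_mul, Nat.sub_zero]
    positivity
  refine lt_of_lt_of_le h0 (Finset.single_le_sum (f := fun i ↦ (m.choose i : ℝ)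
    * ((Nat.descFactorial 2 i : ℝ) * c ^ (2 - i)) * (((m - i)! : ℝ) / ((2 * (m - i))! : ℝ)))
    (fun i _ ↦ by positivity) (Finset.mem_range.2 (Nat.succ_pos m)))

/-! ## §7 The parameters `c₀ = 1/1000`, `K₀ = 1203/5 = 240.6`: certified signs -/

/-- `0 < c₀`. -/
theorem c₀_pos : (0 : ℝ) < c₀ := by norm_num [c₀]

/-- `G(0) = 0.575998 > 0`. -/
theorem re_G_zero_pos : 0 < (G c₀ K₀ 0).re := by
  rw [G_zero, Complex.ofReal_re]; norm_num [c₀, K₀]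

/-- `G c₀ K₀ 0 ≠ 0`. -/
theorem G_zero_ne : G c₀ K₀ 0 ≠ 0 := fun h ↦ by
  have := re_G_zero_pos; rw [h] at this; simp at this

/-- All Taylor coefficients of `G_{c₀,K₀}` are real and positive. -/
theorem taylor_pos (k : ℕ) : (iteratedDeriv k (G c₀ K₀) 0).im = 0 ∧ 0 < (iteratedDeriv k (G c₀ K₀) 0).re := by
  refine ⟨by simpa using im_iteratedDeriv_G_ofReal c₀ K₀ k 0, ?_⟩
  rcases k with _ | m
  · simpa using re_G_zero_pos
  · exact re_iteratedDeriv_succ_G_zero_pos c₀_pos K₀ m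

/-- `G(-c₀) > 0` (certified: `G(-c₀) ≥ K₀ - 2c₀(120 - 8c₀) - 2(120 - 48c₀) = 0.456`). -/
theorem re_G_neg_c₀_pos : 0 < (G c₀ K₀ (-(c₀ : ℂ))).re := by
  have hc0 : (0 : ℝ) < c₀ := c₀_pos
  set t := Real.sqrt c₀ with ht
  have ht0 : 0 < t := Real.sqrt_pos.2 hc0
  have ht2 : t ^ 2 = c₀ := Real.sq_sqrt hc0.le
  have hcast : (-(c₀ : ℂ)) = -(t : ℂ) ^ 2 := by rw [← Complex.ofReal_pow, ht2]
  rw [hcast, G_neg_sq c₀ K₀ ht0.ne', Complex.ofReal_re]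
  have ht4 : t ^ 4 = c₀ ^ 2 := by rw [show t ^ 4 = (t ^ 2) ^ 2 by ring, ht2]
  rw [ht4, ht2]
  have hsin : t * Real.sin t ≤ c₀ := by
    have := Real.sin_le ht0.le; rw [← ht2]; nlinarith
  have hcos : Real.cos t ≤ 1 := Real.cos_le_one t
  norm_num [c₀, K₀] at hsin ⊢
  nlinarith [hsin, hcos]

/-- `G c₀ K₀ (-c₀) ≠ 0`: the degenerate critical point is not a zero. -/
theorem G_neg_c₀_ne : G c₀ K₀ (-(c₀ : ℂ)) ≠ 0 := fun h ↦ by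
  have := re_G_neg_c₀_pos; rw [h] at this; simp at this

/-- The quartic `Q₁(t) = q₁(-t²) > 0` for every real `t`. -/
theorem quartic_pos (t : ℝ) : 0 < t ^ 4 - (2 * c₀ + 20) * t ^ 2 + (c₀ ^ 2 + 12 * c₀ + 120) := by
  norm_num [c₀]; nlinarith [sq_nonneg (t ^ 2 - 10001 / 1000)]

/-- `π · Q₁(π/2) > 240.6` (needs `π` to six digits). -/
theorem K₀_lt_sea_zero :
    K₀ < 2 * (Real.pi / 2) * ((Real.pi / 2) ^ 4 - (2 * c₀ + 20) * (Real.pi / 2) ^ 2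
      + (c₀ ^ 2 + 12 * c₀ + 120)) := by
  have h1 := Real.pi_gt_d6
  have h2 := Real.pi_lt_d6
  have hp := Real.pi_pos
  have h2l : 9.8696 < Real.pi ^ 2 := by nlinarith
  have h2u : Real.pi ^ 2 < 9.86961 := by nlinarith
  have h4l : 97.409 < Real.pi ^ 4 := by nlinarith [h2l]
  have h5l : 306.019 < Real.pi ^ 5 := by nlinarith [h4l, h1]
  have h3u : Real.pi ^ 3 < 31.0064 := by nlinarith [h2u, h2, hp]
  norm_num [c₀, K₀]
  nlinarith [h5l, h3u, h1]

/-- At the sea points: `G(s_j) < 0` for even `j`, `G(s_j) > 0` for odd `j`. -/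
theorem re_G_sea_pos_of_odd {j : ℕ} (hj : Odd j) :
    0 < (G c₀ K₀ (-(((2 * j + 1) * Real.pi / 2 : ℝ) : ℂ) ^ 2)).re := by
  rw [G_sea, Complex.ofReal_re, hj.neg_one_pow]
  have ht := sea_pos j
  have hQ := quartic_pos ((2 * j + 1) * Real.pi / 2)
  have hK : (0 : ℝ) < K₀ := by norm_num [K₀]
  nlinarith [mul_pos ht hQ, hK]

/-- At even-indexed sea points `Re G c₀ K₀ < 0`. -/
theorem re_G_sea_neg_of_even {j : ℕ} (hj : Even j) :
    (G c₀ K₀ (-(((2 * j + 1) * Real.pi / 2 : ℝ) : ℂ) ^ 2)).re < 0 := by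
  rw [G_sea, Complex.ofReal_re, hj.neg_one_pow]
  rcases Nat.eq_zero_or_pos j with rfl | hjpos
  · have h := K₀_lt_sea_zero
    norm_num at h ⊢
    linarith
  · have hj2 : (2 : ℝ) ≤ j := by
      obtain ⟨k, rfl⟩ := hj
      have : 1 ≤ k := by omega
      push_cast; exact_mod_cast (by omega : 2 ≤ k + k)
    have ht7 : 7 ≤ (2 * (j : ℝ) + 1) * Real.pi / 2 := by nlinarith [Real.pi_gt_three, hj2]
    set t := (2 * (j : ℝ) + 1) * Real.pi / 2 with ht
    have ht2 : 49 ≤ t ^ 2 := by nlinarith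
    have hQ : 1000 ≤ t ^ 4 - (2 * c₀ + 20) * t ^ 2 + (c₀ ^ 2 + 12 * c₀ + 120) := by
      norm_num [c₀]
      have h28 : 28 ≤ t ^ 2 - 10001 / 500 := by linarith
      nlinarith [mul_le_mul ht2 h28 (by norm_num) (by positivity)]
    have hK : K₀ < 2 * t * (t ^ 4 - (2 * c₀ + 20) * t ^ 2 + (c₀ ^ 2 + 12 * c₀ + 120)) := by
      have : (K₀ : ℝ) < 14000 := by norm_num [K₀]
      nlinarith [ht7, hQ]
    linarith

/-- `G c₀ K₀` does not vanish at the sea points. -/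
theorem re_G_sea_ne (j : ℕ) : (G c₀ K₀ (-(((2 * j + 1) * Real.pi / 2 : ℝ) : ℂ) ^ 2)).re ≠ 0 := by
  rcases Nat.even_or_odd j with hj | hj
  · exact (re_G_sea_neg_of_even hj).ne
  · exact (re_G_sea_pos_of_odd hj).ne'

/-- `c₀ < ((2j+1)π/2)²`: `-c₀` lies to the right of every sea point. -/
theorem c₀_lt_sea_sq (j : ℕ) : c₀ < ((2 * (j : ℝ) + 1) * Real.pi / 2) ^ 2 := by
  have h := pi_div_two_le_sea j
  have hp := Real.pi_gt_three
  have h1 : (1 : ℝ) < (2 * (j : ℝ) + 1) * Real.pi / 2 := by linarith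
  norm_num [c₀]; nlinarith

/-- **Strict Laguerre sign at every sea point**: `G(s_j) · G''(s_j) < 0`. -/
theorem laguerre_sea (j : ℕ) :
    (G c₀ K₀ (-(((2 * j + 1) * Real.pi / 2 : ℝ) : ℂ) ^ 2)).re
      * (deriv (deriv (G c₀ K₀)) (-(((2 * j + 1) * Real.pi / 2 : ℝ) : ℂ) ^ 2)).re < 0 := by
  rw [deriv_deriv_G_sea, Complex.ofReal_re]
  have ht := sea_pos j
  have hlt := c₀_lt_sea_sq j
  have hsq : 0 < (c₀ - ((2 * (j : ℝ) + 1) * Real.pi / 2) ^ 2) ^ 2 := by nlinarith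
  rcases Nat.even_or_odd j with hj | hj
  · rw [hj.neg_one_pow]
    exact mul_neg_of_neg_of_pos (re_G_sea_neg_of_even hj) (mul_pos hsq (by positivity))
  · rw [hj.neg_one_pow]
    refine mul_neg_of_pos_of_neg (re_G_sea_pos_of_odd hj) (mul_neg_of_pos_of_neg hsq ?_)
    exact div_neg_of_neg_of_pos (by norm_num) (by positivity)

/-! ## §8 The real critical points of `G`: `-c₀` (double) and the sea points -/

/-- Every integer-indexed sea square equals a natural-indexed one. -/
theorem exists_nat_sea_sq_eq (k : ℤ) :
    ∃ j : ℕ, ((2 * (k : ℝ) + 1) * Real.pi / 2) ^ 2 = ((2 * (j : ℝ) + 1) * Real.pi / 2) ^ 2 := by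
  rcases le_or_gt 0 k with hk | hk
  · refine ⟨k.toNat, ?_⟩
    have : ((k.toNat : ℕ) : ℝ) = (k : ℝ) := by exact_mod_cast Int.toNat_of_nonneg hk
    rw [this]
  · refine ⟨(-k - 1).toNat, ?_⟩
    have h1 : 0 ≤ -k - 1 := by omega
    have : (((-k - 1).toNat : ℕ) : ℝ) = ((-k - 1 : ℤ) : ℝ) := by exact_mod_cast Int.toNat_of_nonneg h1
    rw [this]; push_cast; ring

/-- `G'(x) = 0` for real `x` iff `x = -c` or `x` is a sea point `-((2j+1)π/2)²`. -/
theorem deriv_G_ofReal_eq_zero_iff (c K : ℝ) (x : ℝ) :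
    deriv (G c K) x = 0 ↔ x = -c ∨ ∃ j : ℕ, x = -(((2 * j + 1) * Real.pi / 2) ^ 2) := by
  constructor
  · intro h
    rw [deriv_G, mul_eq_zero] at h
    rcases h with h | h
    · left
      have h2 : (x : ℂ) + c = 0 := pow_eq_zero_iff (two_ne_zero) |>.1 h
      have h3 : ((x + c : ℝ) : ℂ) = 0 := by push_cast; exact h2
      have := Complex.ofReal_eq_zero.1 h3
      linarith
    · right
      obtain ⟨k, hk⟩ := exists_eq_seaZero_of_coshSqrt_eq_zero h
      obtain ⟨j, hj⟩ := exists_nat_sea_sq_eq k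
      refine ⟨j, ?_⟩
      have := congrArg Complex.re hk
      simp only [Complex.ofReal_re, Complex.neg_re] at this
      rw [this, hj]
  · rintro (rfl | ⟨j, rfl⟩)
    · push_cast; exact deriv_G_neg_c c K
    · have := deriv_G_sea c K j; push_cast at this ⊢; exact this

/-! ## §14 The polynomial toy (same mechanism, outside the Ξ-like class): `P = X⁴/4 + 5X³/3 + 7X²/2 + 3X + 1`,
`P' = (X+1)²(X+3)` — `P'` hyperbolic, NON-STRICT Laguerre at the critical points, `P` not hyperbolic.
So the `X-4` glue `JointPoly.splits_of_derivative_splits_of_laguerre` is FALSE with `<` weakened to `≤`. -/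

section toy

open Polynomial

/-- Evaluation formula for `Ptoy`. -/
theorem eval_Ptoy (x : ℝ) : Ptoy.eval x = 1 / 4 * x ^ 4 + 5 / 3 * x ^ 3 + 7 / 2 * x ^ 2 + 3 * x + 1 := by
  simp [Ptoy]

/-- `Ptoy' (x) = (x + 1)²(x + 3)`. -/
theorem eval_derivative_Ptoy (x : ℝ) : (derivative Ptoy).eval x = (x + 1) ^ 2 * (x + 3) := by
  simp [Ptoy]; ring

/-- `Ptoy''(x) = 2(x + 1)(x + 3) + (x + 1)²`. -/
theorem eval_derivative_derivative_Ptoy (x : ℝ) :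
    (derivative (derivative Ptoy)).eval x = 2 * (x + 1) * (x + 3) + (x + 1) ^ 2 := by
  simp [Ptoy]; ring

/-- `Ptoy' = (X + 1)²(X + 3)` as polynomials. -/
theorem derivative_Ptoy : derivative Ptoy = (X + C 1) ^ 2 * (X + C 3) :=
  Polynomial.funext fun x ↦ by rw [eval_derivative_Ptoy]; simp

/-- `P'` is hyperbolic. -/
theorem splits_derivative_Ptoy : (derivative Ptoy).Splits := by
  rw [derivative_Ptoy]; exact ((Splits.X_add_C 1).pow 2).mul (Splits.X_add_C 3)

/-- NON-STRICT Laguerre at the critical points of `P` (`-1`: degenerate, product `0`; `-3`: product `-5`). -/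
theorem laguerre_le_Ptoy (x : ℝ) (h1 : (derivative Ptoy).eval x = 0) :
    Ptoy.eval x * (derivative (derivative Ptoy)).eval x ≤ 0 := by
  rw [eval_derivative_Ptoy] at h1
  rcases mul_eq_zero.1 h1 with h | h
  · have hx : x = -1 := by nlinarith [pow_eq_zero_iff (two_ne_zero) |>.1 h]
    subst hx; rw [eval_Ptoy, eval_derivative_derivative_Ptoy]; norm_num
  · have hx : x = -3 := by linarith
    subst hx; rw [eval_Ptoy, eval_derivative_derivative_Ptoy]; norm_num

/-- The degenerate critical point `-1`: `P'(-1) = P''(-1) = 0 ≠ P(-1) = 1/12`. -/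
theorem degenerate_point_Ptoy :
    (derivative Ptoy).eval (-1) = 0 ∧ (derivative (derivative Ptoy)).eval (-1) = 0 ∧ Ptoy.eval (-1) = 1 / 12 := by
  rw [eval_derivative_Ptoy, eval_derivative_derivative_Ptoy, eval_Ptoy]; norm_num

/-- `P` is NOT hyperbolic (strict Laguerre would give `P(-1)·P''(-1) < 0`). -/
theorem not_splits_Ptoy : ¬ Ptoy.Splits := by
  intro h
  have hdeg : 1 ≤ Ptoy.natDegree := by
    by_contra hlt
    obtain ⟨a, ha⟩ := Polynomial.natDegree_eq_zero.1 (by omega : Ptoy.natDegree = 0)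
    have h0 := congrArg (Polynomial.eval (0 : ℝ)) ha
    have h1 := congrArg (Polynomial.eval (-1 : ℝ)) ha
    rw [eval_C, eval_Ptoy] at h0 h1
    norm_num at h0 h1; linarith
  have hx : Ptoy.eval (-1) ≠ 0 := by rw [eval_Ptoy]; norm_num
  have key := Summit.RiemannHypothesis.RiemannHypothesis.Theorems.Splittings.JensenDerivativeLaguerre.laguerre_strict_of_splits
    h hdeg hx
  rw [eval_derivative_Ptoy, eval_derivative_derivative_Ptoy] at key
  norm_num at key

/-- **REFUTED (polynomial level): the `X-4` glue with non-strict sign** —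
«`p'` splits ∧ (`p(x)·p''(x) ≤ 0` at every real critical point `x` of `p`) ⟹ `p` splits» is false. -/
theorem not_splits_of_derivative_splits_of_laguerre_le :
    ¬ (∀ p : ℝ[X], (derivative p).Splits →
        (∀ x : ℝ, (derivative p).eval x = 0 → p.eval x ≠ 0 → p.eval x * (derivative (derivative p)).eval x ≤ 0) →
        p.Splits) := fun h ↦
  not_splits_Ptoy (h Ptoy splits_derivative_Ptoy fun x h1 _ ↦ laguerre_le_Ptoy x h1)

end toy

end Summit.RiemannHypothesis.RiemannHypothesis.Theorems.Splittings.JensenDegenerateCritical
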